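import Summits.QuantumFields.YangMills.Theorems.IR.ShellMaxCorrDoubling

/-!
# Crux `IR` (item stmt-QuantumFields-19354) — line «maximal correlation at one physical thickness»:
the `β = 0` END POINT of the shell format, `Ψ₀(s) = 0` for `s ≥ 1`

Helper module for item `stmt-QuantumFields-19354` (`--supports … --as helper`; it closes nothing; lead prover
ym-ir-line-mxc-p1).  The trivial end of the strong-coupling rung `ShellMaxCorr.stub_shellRung : ShellRung`
(`Theorems/IR/ShellMaxCorrDefs.lean`; OPEN — it asks for `θ = 1/2` on an interval `|β| ≤ β₀`, uniformly in the radius, see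
`Theorems/IR/ShellMaxCorrRungReduction.lean` for the two-layer reduction and the diagnosis): at `β = 0` the torus Wilson
state is product Haar measure (`wilsonMeasure_zero`, from `TorusWilsonGibbs.wilsonMeasure_eq_tilted_pi`), the links of
`B_R` and the links outside `B_{R+s}` (`s ≥ 1`) are disjoint coordinate blocks, hence independent (Mathlib `iIndepFun_pi`,
`iIndepFun.indepFun_finset`), so every covariance in `ShellCorrBound` vanishes: `shellCert_beta_zero : ShellCert ρ 0 S s 0`.
Also `exists_measurable_factor`: a measurable observable depending only on the links of a finite set factors measurably
through the restriction.  A non-vacuity / consistency point of the format, nothing more.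

HONEST FRAMING: no statement at `β ≠ 0`; no mass-gap claim.
-/

set_option autoImplicit false

noncomputable section

open Filter Topology MeasureTheory ProbabilityTheory
open Literature.MathematicalPhysics.QuantumFieldTheory Literature.MathematicalPhysics.QuantumLattice

namespace Summit.QuantumFields.YangMills.Cruxes.IR.ShellMaxCorr

section BetaZero

variable {G : Type} [Group G] [TopologicalSpace G] [IsTopologicalGroup G] [CompactSpace G]
  [MeasurableSpace G] [BorelSpace G]

omit [TopologicalSpace G] [IsTopologicalGroup G] [CompactSpace G] [BorelSpace G] in
/-- A measurable observable depending only on the links of a finite set `D` factors measurably through the restriction to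
`D`. -/
theorem exists_measurable_factor {N : ℕ} (D : Finset (Edge 4 N)) {f : GaugeConfig 4 N G → ℝ} (hfm : Measurable f)
    (hf : DependsOn f (↑D : Set (Edge 4 N))) :
    ∃ φ : (↥D → G) → ℝ, Measurable φ ∧ f = φ ∘ fun (U : GaugeConfig 4 N G) (e : ↥D) => U e := by
  classical
  refine ⟨fun ζ => f fun e => if h : e ∈ D then ζ ⟨e, h⟩ else 1, ?_, ?_⟩
  · refine hfm.comp (measurable_pi_lambda _ fun e => ?_)
    by_cases h : e ∈ D
    · simp only [h, dite_true]; exact measurable_pi_apply _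
    · simp only [h, dite_false]; exact measurable_const
  · funext U
    simp only [Function.comp_apply]
    refine hf fun e he => ?_
    simp [Finset.mem_coe.1 he]

/-- At `β = 0` the torus Wilson state is product Haar measure. -/
theorem wilsonMeasure_zero [SecondCountableTopology G] {n N : ℕ} [NeZero N] (ρ : G →* Matrix (Fin n) (Fin n) ℂ)
    (hρ : Continuous ρ) :
    wilsonMeasure (d := 4) (L := N) ρ 0 = Measure.pi fun _ : Edge 4 N => haarProbability G := by
  rw [wilsonMeasure_eq_tilted_pi ρ hρ 0]
  simp only [neg_zero, zero_mul]
  exact tilted_const _ 0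

/-- **The `β = 0` base point of the shell format: `Ψ₀(s) = 0` for every thickness `s ≥ 1`** (links are independent Haar
variables, and the links of `B_R` are disjoint from the links outside `B_{R+s}`), on every torus and for every inner radius:
`ShellCert ρ 0 S s 0`.  This is the trivial end of the strong-coupling rung `ShellRung` (which asks for `θ = 1/2` on a whole
interval `|β| ≤ β₀`) and a non-vacuity check of the format. -/
theorem shellCert_beta_zero [T2Space G] [SecondCountableTopology G] {n : ℕ} (ρ : G →* Matrix (Fin n) (Fin n) ℂ)
    (hρ : Continuous ρ) (S s : ℕ) (hs : 1 ≤ s) : ShellCert ρ 0 S s 0 := by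
  classical
  intro R f g hfm hgm hfb hgb hf hg
  obtain ⟨Cf, hfC⟩ := hfb
  obtain ⟨Cg, hgC⟩ := hgb
  rw [zero_mul, zero_mul]
  refine le_of_eq (abs_eq_zero.2 ?_)
  rw [wilsonMeasure_zero ρ hρ]
  haveI : IsProbabilityMeasure (Measure.pi fun _ : Edge 4 (2 * S + 1) => haarProbability G) := by infer_instance
  -- the two disjoint link sets
  set D₁ : Finset (Edge 4 (2 * S + 1)) := Finset.univ.filter fun e => InBall R e with hD₁
  set D₂ : Finset (Edge 4 (2 * S + 1)) := Finset.univ.filter fun e => OutBall (R + s) e with hD₂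
  have hdisj : Disjoint D₁ D₂ := by
    rw [Finset.disjoint_left]
    intro e h1 h2
    rw [hD₁, Finset.mem_filter] at h1
    rw [hD₂, Finset.mem_filter] at h2
    have := h1.2.1; have := h2.2.1
    omega
  have hf1 : DependsOn f (↑D₁ : Set (Edge 4 (2 * S + 1))) := hf.mono fun e he => by simp [hD₁, he]
  have hg2 : DependsOn g (↑D₂ : Set (Edge 4 (2 * S + 1))) := hg.mono fun e he => by simp [hD₂, he]
  obtain ⟨φ, hφm, hfφ⟩ := exists_measurable_factor D₁ hfm hf1
  obtain ⟨ψ, hψm, hgψ⟩ := exists_measurable_factor D₂ hgm hg2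
  -- independence of the coordinate blocks under product Haar
  have hind : iIndepFun (fun (e : Edge 4 (2 * S + 1)) (U : GaugeConfig 4 (2 * S + 1) G) => U e)
      (Measure.pi fun _ : Edge 4 (2 * S + 1) => haarProbability G) :=
    iIndepFun_pi (X := fun (_ : Edge 4 (2 * S + 1)) (u : G) => u) fun _ => aemeasurable_id
  have h12 := hind.indepFun_finset D₁ D₂ hdisj fun e => measurable_pi_apply e
  have hfg : IndepFun f g (Measure.pi fun _ : Edge 4 (2 * S + 1) => haarProbability G) := by
    rw [hfφ, hgψ]
    exact h12.comp hφm hψm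
  exact hfg.covariance_eq_zero (memLp_two_of_bdd _ hfm hfC) (memLp_two_of_bdd _ hgm hgC)

end BetaZero

end Summit.QuantumFields.YangMills.Cruxes.IR.ShellMaxCorr

end
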